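import Literature.MathematicalPhysics.QuantumFieldTheory.Balaban1983to89.T3MinimiserStabilityReduction
import Literature.MathematicalPhysics.QuantumFieldTheory.Balaban1983to89.T3PrintedRegularMinimiser
import Literature.MathematicalPhysics.QuantumFieldTheory.Balaban1983to89.T3OrbitAverage
import Literature.MathematicalPhysics.QuantumFieldTheory.Balaban1983to89.B12ContinuousTransportInvariance
import Literature.MathematicalPhysics.QuantumFieldTheory.Balaban1983to89.Node00.CanonicalTransportOfRecord
import Summits.QuantumFields.YangMills.Theorems.FluctuationComparisonRegPrIntLWreg
import HarnessLib

/-!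
# LINE g24-2 «gradient_resolved» — the first-order row GRAD∘ RESOLVED BY HISTORIES on the INTERIOR window:
# GRAD∘ ⟸ GRAD¹∘ (one-bond oscillation of the SMALL-HISTORY fluctuation part) + TAILSUP∘ (fibrewise window odds, zero order, EXISTING row)
# (ideator `ym-r3-idea-1` g24, LENS «control»; companion of LINE g24-1 `Lines/gradient_split.lean`)

Crux of record: `stmt-QuantumFields-20520` = `Summit.QuantumFields.YangMills.Theses.UnitScaleTilt.FluctuationComparisonRegPrIntL` (NOT concluded by name
here; PATH B count of record R3 ⟸ {S1a, 26243, S2α′, S2β, O1} unchanged).  Registry v11.4 `Lines/semiclassical_s2beta.lean` FROZEN (RULING №36): this file is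
PUBLISH-ONLY (no `skeleton check`, no route verb, no Theorems file); it docks BY TEXT onto LINE g24-1's NEW row and onto LINE g22-1's TAILSUP∘.

TARGET (by text, byte-identical to `Lines/gradient_split.lean` §1): GRAD∘ `OneBondOscillationCan` — the one-bond oscillation of the FULL fluctuation part
`f := log ρ + β_K·𝔄^reg_{J,K,ε₀}` of a continuous positive window version `ρ` of the level-`J` nested law is `≤ σ_J`, `σ` super-polynomial; with LINE g24-1's
★`fluctuationPartSmall_of_gradient_split : GRAD∘ → CRUDELOC → S2β` it feeds the registry organ S2β `FluctuationPartSmall`.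

THE RESOLUTION.  Bałaban's (41): `ρ = Σ_histories ρ^{hist}`; single out the SMALL history `g := heightDensityCan^{histGood(b₀′)}` (canonical version of the
`b₀′`-good-history restricted density) and write, at every window datum, `f = f¹ + D` with
  `f¹ := log g + β_K·𝔄^reg`  (the SMALL-HISTORY fluctuation part — Bałaban's small-field effective action minus its classical part) and
  `D := log ρ − log g`        (minus the log-ODDS of a good history in the fibre, up to the normalising constant `a₀`).
Then `|Δ_b f| ≤ |Δ_b f¹| + |Δ_b D|`, and
  • GRAD¹∘ `SmallHistoryOneBondIntCan` (NEW, first order): `|Δ_b f¹| ≤ σ₁(J)` super-polynomially on the INTERIOR window — the one-bond response of the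
    small-field effective action: classical part cancelled at first order (the full-fibre minimum of a small datum lies in the regular fibre,
    [Balaban1985Variational] Thm 1), one-loop part `−½tr(Δ(V)⁻¹∂_bΔ(V)) = O(|F(V)|) = O(θ_J)` times the move `2θ_J`, higher loops `× g_J²` — READ FROM the
    analyticity of the small-field effective densities on a complex neighbourhood of the window ([Balaban1987RG1] Thm 1 (0.19)–(0.26); [Balaban1985UV3] (45)–(47))
    by a Cauchy estimate; NO `λ → ∞` limit, NO determinant representation, NO fibre gap, NO clustering;
  • TAILSUP∘ `WindowOddsSupIntCan` (EXISTING, LINE g22-1 `Lines/multistep_odds.lean` §2, byte-identical; there PROVED ⟸ COND-ODDS∘ ⟸ MSTEP∘ + POS∘):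
    `0 ≤ D − a₀ ≤ τ_J` on the interior window, so `|Δ_b D| ≤ τ_J` (zero order: a difference of two numbers in `[0, τ_J]`).
Hence **GRAD∘ ⟸ GRAD¹∘ ∧ TAILSUP∘** with `σ := σ₁ + τ` (★`oneBondOscillation_of_resolved`, PROVED), and with LINE g24-1: S2β ⟸ {GRAD¹∘, TAILSUP∘, CRUDELOC}.

R3-FLIN PLACEMENT (diagnosis g21 §4–§5, the VARY recipe): both rows are read on the INTERIOR window `θBal F.L γ (c·b₀) p₀ J` with the HISTORY at `b₀`
(shared-shape fraction `∃ c₀ ∀ c ≤ c₀` right after `∀ L`), never on the full window — the full-window TAILSUP `WindowOddsSupCan` is EXPOSED by the boundary layer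
(linearised toy `c_lin(3,n)∕9 ≥ 0.95 > 0.577·π_J`) and is NOT used.  The target GRAD∘ quantifies ALL `b₀ > 0` and is history-free: the junction reads the two rows at
history profile `b₀∕c`, whose interior window `c·(b₀∕c) = b₀` IS GRAD∘'s window (`mul_div_cancel₀`; the registry's `fluctuationPartSmall_of_interiorTable` move).

WHY THIS LINE (beyond g24-1): it names WHERE the first-order content lives — in the small-history term alone (GRAD¹∘), the odds entering at ZERO order — so the
S2β cone after g24-1∕g24-2 has exactly one semiclassical letter, and that letter is a FIRST VARIATION bound (Cauchy estimate on print's analyticity domain), not a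
4-point clustering statement.  WHY NOVEL vs the listed lines: the registry's interior table (g21-3 `interior_table.lean`, registry §3 `fluctuationPartSmall_of_interiorTable`)
resolves S2β by histories at SECOND order (1L4ᶜ∘, H4ᶜ∘, LFR♯ᶜ∘ — limits, det-rep, gap, clustering); g21-1∕g22-1 resolve LFR♯ᶜ (second order) by TAILSUP × CRUDELOC;
this line resolves the FIRST-order row, and its only new letter GRAD¹∘ is first order.  Same additive split `f = f¹ + D` as the registry (credited), one order down.
HONEST RESIDUE: GRAD¹∘ carries depth-uniformity (`K − J` free) of a first-variation bound of the small-field effective action — Bałaban's inductive analyticity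
bounds are uniform in the number of steps, but nothing of that is asserted here; TAILSUP∘ is XL (its own resolution MSTEP∘ + POS∘ is g22-1's, uncharted in print at
`L = 3, 5` beyond the inductive R-operation).  Nothing is proved about YM₃ beyond the junctions.

v2 (same day): GRAD¹∘'s clause (P) — positivity of the small-history density on every interior window — is DISCHARGED IN THIS FILE from the tree's
✓`FluctuationComparisonRegPrIntLWreg.windowRegularity` (p-landed WREG; full `b₀`-window ⊇ interior window by the linearity `θBal (c·b₀) = c·θBal b₀`, `c ≤ 1`):
★`smallHistoryPositiveInt : SmallHistoryPositiveIntCan` PROVED, ✓`smallHistoryOneBond_of_pos_osc : P∘ → OSC¹∘ → GRAD¹∘`; so the NEW letter is the pure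
oscillation clause OSC¹∘ `SmallHistoryOscillationIntCan` ALONE, and the stubs are {OSC¹∘, TAILSUP∘}.

BC7∕BC2∕C0: see the card `Lines/gradient_resolved.md` (probes run on a defs-only copy: GRAD¹∘│YM3TorusSU2, GRAD¹∘│crux CLEAN; must-fail battery GRAD¹∘→GRAD∘,
GRAD∘→GRAD¹∘, GRAD¹∘→crux, TAILSUP∘→GRAD∘ (GRAD¹∘ load-bearing), ⊢GRAD¹∘, ⊢¬GRAD¹∘ all FAIL as required).
-/

noncomputable section

open MeasureTheory Filter Topology Set
open Literature.MathematicalPhysics.QuantumFieldTheory.Balaban1983to89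
open Literature.MathematicalPhysics.QuantumFieldTheory.Balaban1983to89.T3ContinuumYM3Torus
open Literature.MathematicalPhysics.QuantumFieldTheory.Balaban1983to89.T3NestedUnitLaws
open Literature.MathematicalPhysics.QuantumFieldTheory.Balaban1983to89.T3UnitLawDensityEML
open Literature.MathematicalPhysics.QuantumFieldTheory.Balaban1983to89.T3UnitScaleTilt
open Literature.MathematicalPhysics.QuantumFieldTheory.Balaban1983to89.T3TiltDescent
open Literature.MathematicalPhysics.QuantumFieldTheory.Balaban1983to89.T3PrintedRegularMinimiser
open Literature.MathematicalPhysics.QuantumFieldTheory.Balaban1983to89.T3ConstrainedMinimiser (fibre)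
open Literature.MathematicalPhysics.QuantumFieldTheory.Balaban1983to89.T3LevelShift
open Literature.MathematicalPhysics.QuantumFieldTheory.Balaban1983to89.Missing
open Literature.MathematicalPhysics.QuantumFieldTheory.Balaban1983to89.T4Continuum

namespace Summit.QuantumFields.YangMills.Cruxes.FluctuationComparisonRegPrIntL.RunPairOrgan.GradientResolved

/-! ## §0 The canonical version of the restricted height density (verbatim from LINE g18-1 v11 §1 ∕ g21-1 §0a ∕ g22-1 §0) -/

section Canonical

variable (F : T3Family) (γ : ℝ) {J K : ℕ} (hJK : J ≤ K) (S : Set (GaugeField (F.P K) 0 (Matrix.specialUnitaryGroup (Fin 2) ℂ)))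

/-- **THE CANONICAL VERSION OF BAŁABAN'S RESTRICTED DENSITY AT HEIGHT `K − J`** read on the `J`-th tower's finest lattice: the trunk's `heightDensity`
(a chosen Radon–Nikodym version) replaced by `Node00.canonVersion` of its a.e.-class for product Haar — continuous on the maximal open set carrying a
continuous representative and equal there to every such representative. [cite: Balaban1985UV3, (2) p.256 and (41) p.266] -/
def heightDensityCan (V : GaugeField (F.P J) 0 (Matrix.specialUnitaryGroup (Fin 2) ℂ)) : ℝ :=
  Node00.canonVersion (fieldMeasure (F.P J) 0 (Matrix.specialUnitaryGroup (Fin 2) ℂ)) (heightDensity F γ hJK S) V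

end Canonical

section Rows

/-! ## §1 TARGET (by text): GRAD∘ — LINE g24-1's first-order size row -/

/-- **GRAD∘ · ONE-BOND OSCILLATION OF THE FULL FLUCTUATION PART** (`OneBondOscillationCan`) — THE TARGET, byte-identical to `Lines/gradient_split.lean` §1
(there: ★`fluctuationPartSmall_of_gradient_split : GRAD∘ → CRUDELOC → S2β`).  For every continuous positive window version `ρ` of the level-`J` nested law and
every pair of window data agreeing off one bond, `|f U − f V| ≤ σ_J`, `f = log ρ + β_K·minActionRegPr`, `σ` super-polynomial; history-free, all `b₀ > 0`.
WHY IT MIGHT FAIL: see g24-1 (depth-uniform first-order one-loop response; classical residual if the full-fibre minimum left the regular fibre).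
[cite: Balaban1985UV3, (41) p.266 and (45)-(47) p.267; Balaban1985Variational, Thm 1 (8)-(10) p.279; Balaban1987RG1, Thm 1 (0.19)-(0.26)] -/
def OneBondOscillationCan : Prop :=
  ∀ (L : ℕ), ∃ pS : ℝ, ∀ (b₀ p₀ : ℝ), 0 < b₀ → pS ≤ p₀ → 0 < p₀ → ∃ ε₁ : ℝ, 0 < ε₁ ∧ ∀ (ε₀ : ℝ), 0 < ε₀ → ε₀ ≤ ε₁ →
    ∃ γ₁ : ℝ, 0 < γ₁ ∧ ∀ (F : T3Family) (γ : ℝ), F.L = L → 0 < γ → γ ≤ γ₁ →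
      ∃ (σ : ℕ → ℝ), (∀ J, 0 ≤ σ J) ∧ (∀ a : ℕ, Tendsto (fun J : ℕ => ((J : ℝ) + 1) ^ a * σ J) atTop (𝓝 0)) ∧
        ∀ (ν : ℕ → (j : ℕ) → Measure (GaugeField (F.P j) 0 (Matrix.specialUnitaryGroup (Fin 2) ℂ))),
          (∀ K, ν K K = T4GenFunBounds.gibbsMeasure (F.P K) ((F.scheme ℰp γ).β K)) →
          (∀ K j, j < K → ν K j = Measure.map (descend F ℰp j) (ν K (j + 1))) →
          ∀ (J K : ℕ) (hJK : J ≤ K) (ρ : GaugeField (F.P J) 0 (Matrix.specialUnitaryGroup (Fin 2) ℂ) → ℝ),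
            (∀ U, PlaqSmall (θBal F.L γ b₀ p₀ J) U → 0 < ρ U) →
            ν K J = (fieldMeasure _ _ _).withDensity (fun U => ENNReal.ofReal (ρ U)) →
            ContinuousOn ρ {U | PlaqSmall (θBal F.L γ b₀ p₀ J) U} →
            ∀ (b : PBond (F.P J) 0) (U V : GaugeField (F.P J) 0 (Matrix.specialUnitaryGroup (Fin 2) ℂ)),
              PlaqSmall (θBal F.L γ b₀ p₀ J) U → PlaqSmall (θBal F.L γ b₀ p₀ J) V →
              (∀ e, e ≠ b → U e = V e) →
              |(Real.log (ρ U) + (F.scheme ℰp γ).β K * minActionRegPr F J K hJK ε₀ U)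
                  - (Real.log (ρ V) + (F.scheme ℰp γ).β K * minActionRegPr F J K hJK ε₀ V)| ≤ σ J

/-! ## §2 THE ROWS: GRAD¹∘ (NEW, first order, interior) and TAILSUP∘ (EXISTING, zero order, interior) -/

/-- **GRAD¹∘ · ONE-BOND OSCILLATION OF THE SMALL-HISTORY FLUCTUATION PART — INTERIOR WINDOW, ALL DEPTHS** (`SmallHistoryOneBondIntCan`, NEW): with the
shared-shape fraction `∃ c₀ ∀ c ≤ c₀` after `∀ L`: for every run `K ≥ J`, (P) the canonical `b₀`-good-history density `g := heightDensityCan^{histGood(b₀)}` is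
positive on the INTERIOR window `θBal F.L γ (c·b₀) p₀ J` (closed content: ✓WREG `windowRegularity` gives it on the full window), and for every pair of interior
data agreeing off one bond `|(log g U + β_K·𝔄^reg U) − (log g V + β_K·𝔄^reg V)| ≤ σ₁(J)`, `σ₁` super-polynomial, uniformly in `K`.  This is a FIRST-VARIATION
bound of Bałaban's small-field effective action (minus its classical part) w.r.t. the background: classical response cancelled at first order
([Balaban1985Variational] Thm 1), one loop `O(θ_J)·(move 2θ_J)`, higher loops `× g_J²`, READ FROM the analyticity of the effective densities by a Cauchy estimate.
WHY IT MIGHT FAIL: (a) depth-uniformity needs the renormalised first-order vacuum-polarisation response summed over the `K − J` free levels to stay `O(polylog)`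
(`ℰp` must absorb it — 3-d super-renormalisability, (45)–(47)); (b) the toron (flat, non-trivial holonomy) directions of T³ contribute a one-bond response
`O(N_J^{−2})` not controlled by `|F|` — geometric in `J` for fixed `F` (and `σ₁` is chosen after `F`), but a genuine finite-size term; (c) the `hist(b₀)` restriction
makes `g` NON-smooth where a fine plaquette of the minimiser crosses `θ_{j}(b₀)` — on the INTERIOR window (`c ≤ c₀(L)`) the minimiser's history is interior too
(EXW-type exactness), on the full window it is not (R3-FLIN): hence interior only.  Instrument: FL-12 (one-bond response column on the R3-ONELOOP-4PT rig).
[cite: Balaban1987RG1, Thm 1 (0.19)-(0.26); Balaban1985UV3, (41) p.266 and (45)-(47) p.267; Balaban1985Variational, Thm 1 (8)-(10) p.279;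
Balaban1989LargeFieldII, (1.66)-(1.67) p.376] -/
def SmallHistoryOneBondIntCan : Prop :=
  ∀ (L : ℕ), ∃ c₀ : ℝ, 0 < c₀ ∧ c₀ ≤ 1 ∧ ∀ (c : ℝ), 0 < c → c ≤ c₀ → ∃ pS : ℝ, ∀ (b₀ p₀ : ℝ), 0 < b₀ → pS ≤ p₀ → 0 < p₀ →
    ∃ ε₁ : ℝ, 0 < ε₁ ∧ ∀ (ε₀ : ℝ), 0 < ε₀ → ε₀ ≤ ε₁ →
    ∃ γ₁ : ℝ, 0 < γ₁ ∧ ∀ (F : T3Family) (γ : ℝ), F.L = L → 0 < γ → γ ≤ γ₁ →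
      ∃ σ₁ : ℕ → ℝ, (∀ J, 0 ≤ σ₁ J) ∧ (∀ a : ℕ, Tendsto (fun J : ℕ => ((J : ℝ) + 1) ^ a * σ₁ J) atTop (𝓝 0)) ∧
        ∀ (J K : ℕ) (hJK : J ≤ K),
          (∀ U : GaugeField (F.P J) 0 (Matrix.specialUnitaryGroup (Fin 2) ℂ), PlaqSmall (θBal F.L γ (c * b₀) p₀ J) U →
              0 < heightDensityCan F γ hJK (histGood F ℰp (θBal F.L γ b₀ p₀) K J) U) ∧
          ∀ (b : PBond (F.P J) 0) (U V : GaugeField (F.P J) 0 (Matrix.specialUnitaryGroup (Fin 2) ℂ)),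
            PlaqSmall (θBal F.L γ (c * b₀) p₀ J) U → PlaqSmall (θBal F.L γ (c * b₀) p₀ J) V →
            (∀ e, e ≠ b → U e = V e) →
            |(Real.log (heightDensityCan F γ hJK (histGood F ℰp (θBal F.L γ b₀ p₀) K J) U)
                + (F.scheme ℰp γ).β K * minActionRegPr F J K hJK ε₀ U)
              - (Real.log (heightDensityCan F γ hJK (histGood F ℰp (θBal F.L γ b₀ p₀) K J) V)
                + (F.scheme ℰp γ).β K * minActionRegPr F J K hJK ε₀ V)| ≤ σ₁ J

/-- **GRAD¹₁∘ · THE FIRST RUNG** (`SmallHistoryOneBondDepthOneIntCan`): GRAD¹∘ on the runs `K = J + 1` only — the one-bond response of the ONE-STEP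
small-field effective action (one Gaussian-dominated constrained fibre integral over `histGood` at one level; the one-step chart ∕ Laplace tools of ✓WREG,
KPL-E apply).  PROVED from GRAD¹∘ (✓`smallHistoryOneBondDepthOne_of`); the hands' entry point. [cite: Balaban1985UV3, (38)-(41) p.266] -/
def SmallHistoryOneBondDepthOneIntCan : Prop :=
  ∀ (L : ℕ), ∃ c₀ : ℝ, 0 < c₀ ∧ c₀ ≤ 1 ∧ ∀ (c : ℝ), 0 < c → c ≤ c₀ → ∃ pS : ℝ, ∀ (b₀ p₀ : ℝ), 0 < b₀ → pS ≤ p₀ → 0 < p₀ →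
    ∃ ε₁ : ℝ, 0 < ε₁ ∧ ∀ (ε₀ : ℝ), 0 < ε₀ → ε₀ ≤ ε₁ →
    ∃ γ₁ : ℝ, 0 < γ₁ ∧ ∀ (F : T3Family) (γ : ℝ), F.L = L → 0 < γ → γ ≤ γ₁ →
      ∃ σ₁ : ℕ → ℝ, (∀ J, 0 ≤ σ₁ J) ∧ (∀ a : ℕ, Tendsto (fun J : ℕ => ((J : ℝ) + 1) ^ a * σ₁ J) atTop (𝓝 0)) ∧
        ∀ (J : ℕ) (hJK : J ≤ J + 1),
          (∀ U : GaugeField (F.P J) 0 (Matrix.specialUnitaryGroup (Fin 2) ℂ), PlaqSmall (θBal F.L γ (c * b₀) p₀ J) U →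
              0 < heightDensityCan F γ hJK (histGood F ℰp (θBal F.L γ b₀ p₀) (J + 1) J) U) ∧
          ∀ (b : PBond (F.P J) 0) (U V : GaugeField (F.P J) 0 (Matrix.specialUnitaryGroup (Fin 2) ℂ)),
            PlaqSmall (θBal F.L γ (c * b₀) p₀ J) U → PlaqSmall (θBal F.L γ (c * b₀) p₀ J) V →
            (∀ e, e ≠ b → U e = V e) →
            |(Real.log (heightDensityCan F γ hJK (histGood F ℰp (θBal F.L γ b₀ p₀) (J + 1) J) U)
                + (F.scheme ℰp γ).β (J + 1) * minActionRegPr F J (J + 1) hJK ε₀ U)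
              - (Real.log (heightDensityCan F γ hJK (histGood F ℰp (θBal F.L γ b₀ p₀) (J + 1) J) V)
                + (F.scheme ℰp γ).β (J + 1) * minActionRegPr F J (J + 1) hJK ε₀ V)| ≤ σ₁ J

/-- GRAD¹∘ ⇒ GRAD¹₁∘ (specialisation to `K = J + 1`). -/
theorem smallHistoryOneBondDepthOne_of (h : SmallHistoryOneBondIntCan) : SmallHistoryOneBondDepthOneIntCan := by
  intro L
  obtain ⟨c₀, hc₀, hc₀1, H⟩ := h L
  refine ⟨c₀, hc₀, hc₀1, fun c hc hcle => ?_⟩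
  obtain ⟨pS, H⟩ := H c hc hcle
  refine ⟨pS, fun b₀ p₀ hb hpS hp => ?_⟩
  obtain ⟨ε₁, hε₁, H⟩ := H b₀ p₀ hb hpS hp
  refine ⟨ε₁, hε₁, fun ε₀ hε₀ hε₀1 => ?_⟩
  obtain ⟨γ₁, hγ₁, H⟩ := H ε₀ hε₀ hε₀1
  refine ⟨γ₁, hγ₁, fun F γ hFL hγ hγle => ?_⟩
  obtain ⟨σ₁, hσ0, hσt, H⟩ := H F γ hFL hγ hγle
  exact ⟨σ₁, hσ0, hσt, fun J hJK => H J (J + 1) hJK⟩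

/-! ## §2b (v2) GRAD¹∘ = P∘ (CLOSED: ✓WREG) + OSC¹∘ (the letter) -/

/-- Bałaban's thresholds are linear in the profile constant: `θ_{c·b₀}(i) = c·θ_{b₀}(i)`. [cite: Balaban1985UV3, (7) p.257] -/
theorem θBal_const_mul' (L : ℕ) (γ c b₀ p₀ : ℝ) (i : ℕ) : θBal L γ (c * b₀) p₀ i = c * θBal L γ b₀ p₀ i := by
  unfold θBal B10.pFun; ring

/-- `θBal ≥ 0` for `γ ≤ 1`, `0 ≤ b₀` (any `L : ℕ`; `√` of a negative number is `0`). [cite: Balaban1985UV3, (7) p.257] -/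
theorem θBal_nonneg' (L : ℕ) {γ b₀ : ℝ} (p₀ : ℝ) (hγ1 : γ ≤ 1) (hb : 0 ≤ b₀) (i : ℕ) : 0 ≤ θBal L γ b₀ p₀ i := by
  unfold θBal B10.pFun
  have hL0 : (0 : ℝ) ≤ ((L : ℝ)⁻¹) := inv_nonneg.mpr (Nat.cast_nonneg L)
  have hx1 : γ * ((L : ℝ)⁻¹) ^ i ≤ 1 :=
    calc γ * ((L : ℝ)⁻¹) ^ i ≤ 1 * 1 := mul_le_mul hγ1 (pow_le_one₀ hL0 (Nat.cast_inv_le_one L)) (pow_nonneg hL0 i) zero_le_one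
      _ = 1 := one_mul 1
  have hg1 : Real.sqrt (γ * ((L : ℝ)⁻¹) ^ i) ≤ 1 := (Real.sqrt_le_sqrt hx1).trans_eq Real.sqrt_one
  have hlog : 0 ≤ Real.log (Real.sqrt (γ * ((L : ℝ)⁻¹) ^ i))⁻¹ := by
    rcases (Real.sqrt_nonneg (γ * ((L : ℝ)⁻¹) ^ i)).eq_or_lt with h | h
    · rw [← h]; simp
    · exact Real.log_nonneg ((one_le_inv_iff₀).mpr ⟨h, hg1⟩)
  exact mul_nonneg (Real.sqrt_nonneg _) (mul_nonneg hb (Real.rpow_nonneg (by linarith) _))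

/-- The interior window lies inside the `b₀`-window (`c ≤ 1`). -/
theorem plaqSmall_of_interior {F : T3Family} {γ b₀ p₀ c : ℝ} (hγ1 : γ ≤ 1) (hb : 0 ≤ b₀) (hc1 : c ≤ 1) (J : ℕ)
    {U : GaugeField (F.P J) 0 (Matrix.specialUnitaryGroup (Fin 2) ℂ)} (hU : PlaqSmall (θBal F.L γ (c * b₀) p₀ J) U) :
    PlaqSmall (θBal F.L γ b₀ p₀ J) U :=
  fun p => (hU p).trans_le (by rw [θBal_const_mul']; exact mul_le_of_le_one_left (θBal_nonneg' F.L p₀ hγ1 hb J) hc1)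

/-- **P∘ · POSITIVITY OF THE SMALL-HISTORY DENSITY ON EVERY INTERIOR WINDOW** (`SmallHistoryPositiveIntCan`; CLOSED CONTENT — PROVED below from the tree's
✓`windowRegularity`): for `γ ≤ γ₁(L, b₀, p₀)`, every `c ∈ (0, 1]`, every run `K ≥ J`, the canonical `b₀`-good-history density is positive on the interior window
`θBal F.L γ (c·b₀) p₀ J`. [cite: Balaban1985Averaging, (10) p.19; Balaban1985UV3, (41) p.266] -/
def SmallHistoryPositiveIntCan : Prop :=
  ∀ (L : ℕ) (b₀ p₀ : ℝ), 0 < b₀ → 0 < p₀ → ∃ γ₁ : ℝ, 0 < γ₁ ∧ ∀ (F : T3Family) (γ : ℝ), F.L = L → 0 < γ → γ ≤ γ₁ →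
    ∀ (c : ℝ), 0 < c → c ≤ 1 → ∀ (J K : ℕ) (hJK : J ≤ K) (U : GaugeField (F.P J) 0 (Matrix.specialUnitaryGroup (Fin 2) ℂ)),
      PlaqSmall (θBal F.L γ (c * b₀) p₀ J) U → 0 < heightDensityCan F γ hJK (histGood F ℰp (θBal F.L γ b₀ p₀) K J) U

/-- ★ P∘ PROVED from ✓WREG (`γ₁ := min γ₁^{WREG} 1`, density coupling `γ' := γ`). -/
theorem smallHistoryPositiveInt : SmallHistoryPositiveIntCan := by
  intro L b₀ p₀ hb₀ hp₀
  obtain ⟨γW, hγW, HW⟩ :=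
    Summit.QuantumFields.YangMills.Theorems.FluctuationComparisonRegPrIntLWreg.windowRegularity L b₀ p₀ hb₀ hp₀
  refine ⟨min γW 1, lt_min hγW one_pos, ?_⟩
  intro F γ hFL hγ hγ1 c hc hc1 J K hJK U hU
  have hU' : PlaqSmall (θBal F.L γ b₀ p₀ J) U := plaqSmall_of_interior (hγ1.trans (min_le_right _ _)) hb₀.le hc1 J hU
  exact (HW F γ hFL hγ (hγ1.trans (min_le_left _ _)) J K hJK γ hγ).2 U hU'

/-- **OSC¹∘ · THE LETTER** (`SmallHistoryOscillationIntCan`, NEW, first order, interior): GRAD¹∘ without its positivity clause — the one-bond oscillation of the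
small-history fluctuation part `f¹ = log heightDensityCan^{histGood(b₀)} + β_K·𝔄^reg` on the interior window is `≤ σ₁(J)` super-polynomially, uniformly in the
depth.  Why it might fail: as GRAD¹∘ (a)–(c).  [cite: Balaban1987RG1, Thm 1 (0.19)-(0.26); Balaban1985UV3, (45)-(47) p.267; Balaban1985Variational, Thm 1 (8)-(10) p.279] -/
def SmallHistoryOscillationIntCan : Prop :=
  ∀ (L : ℕ), ∃ c₀ : ℝ, 0 < c₀ ∧ c₀ ≤ 1 ∧ ∀ (c : ℝ), 0 < c → c ≤ c₀ → ∃ pS : ℝ, ∀ (b₀ p₀ : ℝ), 0 < b₀ → pS ≤ p₀ → 0 < p₀ →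
    ∃ ε₁ : ℝ, 0 < ε₁ ∧ ∀ (ε₀ : ℝ), 0 < ε₀ → ε₀ ≤ ε₁ →
    ∃ γ₁ : ℝ, 0 < γ₁ ∧ ∀ (F : T3Family) (γ : ℝ), F.L = L → 0 < γ → γ ≤ γ₁ →
      ∃ σ₁ : ℕ → ℝ, (∀ J, 0 ≤ σ₁ J) ∧ (∀ a : ℕ, Tendsto (fun J : ℕ => ((J : ℝ) + 1) ^ a * σ₁ J) atTop (𝓝 0)) ∧
        ∀ (J K : ℕ) (hJK : J ≤ K) (b : PBond (F.P J) 0) (U V : GaugeField (F.P J) 0 (Matrix.specialUnitaryGroup (Fin 2) ℂ)),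
            PlaqSmall (θBal F.L γ (c * b₀) p₀ J) U → PlaqSmall (θBal F.L γ (c * b₀) p₀ J) V →
            (∀ e, e ≠ b → U e = V e) →
            |(Real.log (heightDensityCan F γ hJK (histGood F ℰp (θBal F.L γ b₀ p₀) K J) U)
                + (F.scheme ℰp γ).β K * minActionRegPr F J K hJK ε₀ U)
              - (Real.log (heightDensityCan F γ hJK (histGood F ℰp (θBal F.L γ b₀ p₀) K J) V)
                + (F.scheme ℰp γ).β K * minActionRegPr F J K hJK ε₀ V)| ≤ σ₁ J

/-- ✓ P∘ → OSC¹∘ → GRAD¹∘ (`γ₁ := min`, `c ≤ c₀ ≤ 1`). -/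
theorem smallHistoryOneBond_of_pos_osc (hP : SmallHistoryPositiveIntCan) (hO : SmallHistoryOscillationIntCan) :
    SmallHistoryOneBondIntCan := by
  intro L
  obtain ⟨c₀, hc₀, hc₀1, HO⟩ := hO L
  refine ⟨c₀, hc₀, hc₀1, ?_⟩
  intro c hc hcc₀
  obtain ⟨pS, HpS⟩ := HO c hc hcc₀
  refine ⟨pS, ?_⟩
  intro b₀ p₀ hb₀ hpS hp₀
  obtain ⟨ε₁, hε₁, Hε⟩ := HpS b₀ p₀ hb₀ hpS hp₀
  refine ⟨ε₁, hε₁, ?_⟩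
  intro ε₀ hε₀ hε₀1
  obtain ⟨γO, hγO, HγO⟩ := Hε ε₀ hε₀ hε₀1
  obtain ⟨γP, hγP, HγP⟩ := hP L b₀ p₀ hb₀ hp₀
  refine ⟨min γO γP, lt_min hγO hγP, ?_⟩
  intro F γ hFL hγ hγ1
  obtain ⟨σ₁, hσ0, hσT, Hσ⟩ := HγO F γ hFL hγ (hγ1.trans (min_le_left _ _))
  refine ⟨σ₁, hσ0, hσT, ?_⟩
  intro J K hJK
  exact ⟨fun U hU => HγP F γ hFL hγ (hγ1.trans (min_le_right _ _)) c hc (hcc₀.trans hc₀1) J K hJK U hU,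
    fun b U V hU hV hUV => Hσ J K hJK b U V hU hV hUV⟩

/-- ★ OSC¹∘ → GRAD¹∘ (P∘ supplied by ✓`smallHistoryPositiveInt`). -/
theorem smallHistoryOneBond_of_osc (hO : SmallHistoryOscillationIntCan) : SmallHistoryOneBondIntCan :=
  smallHistoryOneBond_of_pos_osc smallHistoryPositiveInt hO

/-- **TAILSUP∘ · FIBREWISE WINDOW ODDS — INTERIOR WINDOW, ALL DEPTHS** (`WindowOddsSupIntCan`) — EXISTING ROW, byte-identical to LINE g22-1
`Lines/multistep_odds.lean` §2 (there PROVED ⟸ COND-ODDS∘ ⟸ MSTEP∘ + POS∘).  For every continuous positive interior-window version `ρ` of the level-`J` law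
there is a constant `a₀` with `0 ≤ log ρ U − a₀ − log heightDensityCan^{histGood(b₀)} U ≤ τ_J` at every INTERIOR datum, `τ` super-polynomial, uniformly in `K`.
WHY IT MIGHT FAIL: the conditional probability of a `b₀`-good history given an interior level-`J` datum must be `≥ e^{−τ_J}` uniformly in the depth — at
`L = 3, 5` not obtainable level by level (g22-1 (2)); XL. [cite: Balaban1989LargeFieldII, (1.77)-(1.79) p.383 and (1.95) p.389; Balaban1985UV3, (38)-(40) p.266] -/
def WindowOddsSupIntCan : Prop :=
  ∀ (L : ℕ), ∃ c₀ : ℝ, 0 < c₀ ∧ c₀ ≤ 1 ∧ ∀ (c : ℝ), 0 < c → c ≤ c₀ → ∃ pS : ℝ, ∀ (b₀ p₀ : ℝ), 0 < b₀ → pS ≤ p₀ → 0 < p₀ →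
    ∃ γ₁ : ℝ, 0 < γ₁ ∧ ∀ (F : T3Family) (γ : ℝ), F.L = L → 0 < γ → γ ≤ γ₁ →
      ∃ τ : ℕ → ℝ, (∀ J, 0 ≤ τ J) ∧ (∀ a : ℕ, Tendsto (fun J : ℕ => ((J : ℝ) + 1) ^ a * τ J) atTop (𝓝 0)) ∧
        ∀ (ν : ℕ → (j : ℕ) → Measure (GaugeField (F.P j) 0 (Matrix.specialUnitaryGroup (Fin 2) ℂ))),
          (∀ K, ν K K = T4GenFunBounds.gibbsMeasure (F.P K) ((F.scheme ℰp γ).β K)) →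
          (∀ K j, j < K → ν K j = Measure.map (descend F ℰp j) (ν K (j + 1))) →
          ∀ (J K : ℕ) (hJK : J ≤ K) (ρ : GaugeField (F.P J) 0 (Matrix.specialUnitaryGroup (Fin 2) ℂ) → ℝ),
            (∀ U, PlaqSmall (θBal F.L γ (c * b₀) p₀ J) U → 0 < ρ U) →
            ν K J = (fieldMeasure _ _ _).withDensity (fun U => ENNReal.ofReal (ρ U)) →
            ContinuousOn ρ {U | PlaqSmall (θBal F.L γ (c * b₀) p₀ J) U} →
            (∀ U : GaugeField (F.P J) 0 (Matrix.specialUnitaryGroup (Fin 2) ℂ), PlaqSmall (θBal F.L γ (c * b₀) p₀ J) U →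
                0 < heightDensityCan F γ hJK (histGood F ℰp (θBal F.L γ b₀ p₀) K J) U) →
            ∃ a₀ : ℝ, ∀ U : GaugeField (F.P J) 0 (Matrix.specialUnitaryGroup (Fin 2) ℂ), PlaqSmall (θBal F.L γ (c * b₀) p₀ J) U →
              0 ≤ Real.log (ρ U) - a₀ - Real.log (heightDensityCan F γ hJK (histGood F ℰp (θBal F.L γ b₀ p₀) K J) U) ∧
              Real.log (ρ U) - a₀ - Real.log (heightDensityCan F γ hJK (histGood F ℰp (θBal F.L γ b₀ p₀) K J) U) ≤ τ J

/-! ## §3 PROVED: GRAD¹∘ → TAILSUP∘ → GRAD∘ (common fraction `c := min c₁ c₂`, rows read at profile `b₀ ∕ c`, `f = f¹ + D`, `σ := σ₁ + τ`) -/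

/-- The suffices-statement of the line. -/
def ResolvedSuffices : Prop := SmallHistoryOneBondIntCan → WindowOddsSupIntCan → OneBondOscillationCan

/-- A difference of two numbers in `[0, t]` has absolute value `≤ t`. -/
theorem abs_sub_le_of_mem_Icc {x y t : ℝ} (hx0 : 0 ≤ x) (hxt : x ≤ t) (hy0 : 0 ≤ y) (hyt : y ≤ t) : |x - y| ≤ t := by
  rw [abs_le]; constructor <;> linarith

/-- **COMPOSITION · GRAD¹∘ → TAILSUP∘ → GRAD∘ (PROVED)**: common window fraction `c := min c₁ c₂`; both rows read at history profile `b₀ ∕ c`, whose interior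
window `c · (b₀ ∕ c) = b₀` IS GRAD∘'s window; then `f U − f V = [f¹ U − f¹ V] + [(log ρ U − a₀ − log g U) − (log ρ V − a₀ − log g V)]`, the first bracket
`≤ σ₁ J` (GRAD¹∘), the second a difference of two numbers in `[0, τ J]` (TAILSUP∘, fed GRAD¹∘'s positivity clause), so `σ := σ₁ + τ` (super-polynomial) serves.
[cite: Balaban1985UV3, (41) p.266; Balaban1989LargeFieldII, (1.77)-(1.79) p.383] -/
theorem oneBondOscillation_of_resolved : ResolvedSuffices := by
  intro h1 h2 L
  obtain ⟨c₁, hc₁, -, H1⟩ := h1 L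
  obtain ⟨c₂, hc₂, -, H2⟩ := h2 L
  -- ONE COMMON WINDOW FRACTION `c := min c₁ c₂`
  obtain ⟨c, hc, hcle₁, hcle₂⟩ : ∃ c : ℝ, 0 < c ∧ c ≤ c₁ ∧ c ≤ c₂ :=
    ⟨min c₁ c₂, lt_min hc₁ hc₂, min_le_left _ _, min_le_right _ _⟩
  obtain ⟨pS₁, H1⟩ := H1 c hc hcle₁
  obtain ⟨pS₂, H2⟩ := H2 c hc hcle₂
  refine ⟨max pS₁ pS₂, fun b₀ p₀ hb hpS hp => ?_⟩
  -- THE `b₀ ∕ c` INSTANTIATION: interior window `c · (b₀ ∕ c) = b₀` = GRAD∘'s window; history profile `b₀ ∕ c`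
  have hb' : 0 < b₀ / c := div_pos hb hc
  have e : c * (b₀ / c) = b₀ := mul_div_cancel₀ b₀ hc.ne'
  obtain ⟨ε₁, hε₁, H1⟩ := H1 (b₀ / c) p₀ hb' ((le_max_left _ _).trans hpS) hp
  obtain ⟨γ₂, hγ₂, H2⟩ := H2 (b₀ / c) p₀ hb' ((le_max_right _ _).trans hpS) hp
  refine ⟨ε₁, hε₁, fun ε₀ hε₀ hε₀1 => ?_⟩
  obtain ⟨γ₁, hγ₁, H1⟩ := H1 ε₀ hε₀ hε₀1
  refine ⟨min γ₁ γ₂, lt_min hγ₁ hγ₂, fun F γ hFL hγ hγle => ?_⟩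
  obtain ⟨σ₁, hσ0, hσt, H1⟩ := H1 F γ hFL hγ (hγle.trans (min_le_left _ _))
  obtain ⟨τ, hτ0, hτt, H2⟩ := H2 F γ hFL hγ (hγle.trans (min_le_right _ _))
  -- rewrite the rows' interior window `θBal F.L γ (c * (b₀ / c)) p₀ J` to GRAD∘'s window `θBal F.L γ b₀ p₀ J`
  simp only [e] at H1 H2
  refine ⟨fun J => σ₁ J + τ J, fun J => add_nonneg (hσ0 J) (hτ0 J), fun a => ?_, ?_⟩
  · have h := (hσt a).add (hτt a)
    rw [add_zero] at h
    refine h.congr' (Eventually.of_forall fun J => ?_)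
    ring
  · intro ν hνK hνd J K hJK ρ hρpos hνρ hρcont b U V hU hV hUV
    obtain ⟨hgpos, H1q⟩ := H1 J K hJK
    obtain ⟨a₀, H2q⟩ := H2 ν hνK hνd J K hJK ρ hρpos hνρ hρcont hgpos
    have hf1 := H1q b U V hU hV hUV
    obtain ⟨hU0, hU1⟩ := H2q U hU
    obtain ⟨hV0, hV1⟩ := H2q V hV
    have hD := abs_sub_le_of_mem_Icc hU0 hU1 hV0 hV1
    -- `f U − f V = [f¹ U − f¹ V] + [D U − D V]`
    have key :
        (Real.log (ρ U) + (F.scheme ℰp γ).β K * minActionRegPr F J K hJK ε₀ U)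
          - (Real.log (ρ V) + (F.scheme ℰp γ).β K * minActionRegPr F J K hJK ε₀ V)
        = ((Real.log (heightDensityCan F γ hJK (histGood F ℰp (θBal F.L γ (b₀ / c) p₀) K J) U)
              + (F.scheme ℰp γ).β K * minActionRegPr F J K hJK ε₀ U)
            - (Real.log (heightDensityCan F γ hJK (histGood F ℰp (θBal F.L γ (b₀ / c) p₀) K J) V)
              + (F.scheme ℰp γ).β K * minActionRegPr F J K hJK ε₀ V))
          + ((Real.log (ρ U) - a₀ - Real.log (heightDensityCan F γ hJK (histGood F ℰp (θBal F.L γ (b₀ / c) p₀) K J) U))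
            - (Real.log (ρ V) - a₀ - Real.log (heightDensityCan F γ hJK (histGood F ℰp (θBal F.L γ (b₀ / c) p₀) K J) V))) := by
      ring
    show |_| ≤ σ₁ J + τ J
    rw [key]
    exact (abs_add_le _ _).trans (add_le_add hf1 hD)

/-! ## §4 Hand-over in the registry's currency: the DOOR GRAD¹∘ ∧ TAILSUP∘ ∧ CRUDELOC ⊢ S2β is LINE g24-1's ★ composed with this ★ (stated in the card;
no Lines module is importable, so the composition with `fluctuationPartSmall_of_gradient_split` is by text: this file's `OneBondOscillationCan` is
byte-identical to g24-1's). -/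

end Rows

/-! ## §5 Stubs (the two letters of this line) and the stub-composition -/

section Stubs

/-- STUB · OSC¹∘ (NEW, first order, interior; size M–L) — the line's one NEW letter (v2: P∘ is proved in §2b). -/
theorem stub_smallHistoryOscillationIntCan : SmallHistoryOscillationIntCan := by
  sorry

/-- STUB · TAILSUP∘ (EXISTING row of LINE g22-1, there resolved ⟸ COND-ODDS∘ ⟸ MSTEP∘ + POS∘; XL). -/
theorem stub_windowOddsSupIntCan : WindowOddsSupIntCan := by
  sorry

/-- GRAD¹∘ from the stub OSC¹∘ and the PROVED P∘ (no new sorry). -/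
theorem smallHistoryOneBondInt_of_stubs : SmallHistoryOneBondIntCan :=
  smallHistoryOneBond_of_osc stub_smallHistoryOscillationIntCan

/-- The first rung from the stub (no new sorry). -/
theorem stub_smallHistoryOneBondDepthOneIntCan : SmallHistoryOneBondDepthOneIntCan :=
  smallHistoryOneBondDepthOne_of smallHistoryOneBondInt_of_stubs

/-- GRAD∘ from the two stubs through the PROVED compositions (sorries only inside the two stubs). -/
theorem oneBondOscillation_of_stubs : OneBondOscillationCan :=
  oneBondOscillation_of_resolved smallHistoryOneBondInt_of_stubs stub_windowOddsSupIntCan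

end Stubs

end Summit.QuantumFields.YangMills.Cruxes.FluctuationComparisonRegPrIntL.RunPairOrgan.GradientResolved
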